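/-
Copyright (c) 2026 the pub-hodgecm-mathlib formalisation cell (harness21).  Prover seat hodgecm-mathlib-LH4-p09 (g9), req620 Track A «(D-RAM) FOUR-FRAME» squad
(STAGE-1b, row (2) of the piece `f_{T₊}`, the (β₂) road; dealer∕pen LH4-plan (g13) WORD #102: (β₂-H) owner; statement memo `SIG-beta2H.v1` 8901ac1d of LH4-p04 (g7)), 2026-09-04.
-/
import Summits.HodgeConjecture.HodgeConjecture.Theorems.F0P3cDyRamToricCensusDefs   -- ★ DEFS leaf (LH4-p12 (g4)): `IsOrd`, `dualGen`, `levelSet`, `levelSetDep`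
import HarnessLib

/-!
# Crux `H413`, line LH4 «(D-RAM) FOUR-FRAME» — STAGE-1b, row (2), the (β₂) road, brick (β₂-H) ENGINE: «A LABEL-REVERSING SYMMETRY OF A CONE CELL FORCES HALF∕HALF»
# and the axis-cell symmetry `Λ ↦ ε·Λ` (`ε·Θε = 1`) of the level sets `levelSet ∕ levelSetDep` of ★ `F0P3cDyRamToricCensusDefs`

Cell `hodgecm-mathlib` (D-0151), FLOOR 0, crux item H413 = `stmt-HodgeConjecture-24833`, route of record `HCCMUnconditional`; squad F0∕P3c∕LH4; lane
`--supports stmt-HodgeConjecture-24833 --as helper` (count-neutral; pays NO tier-0 row).  THEOREMS ONLY (no `def`, no instance, no notation, no `sorry`, default heartbeats).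
DATUM-FREE (`K` any field with `Valued K ℤᵐ⁰`, `ρ Θ : K →+* K` arbitrary ring maps, no residue field, no `|2|`, no self-duality).

WHY.  The (β₂) letter of the piece `f_{T₊}` (`betaT2.letter.v1` cd9aa77b, DIFFERENCE form; HYPOTHESIS of ★ p860076 ∕ ★ p860151) splits, by the mechanism of record (LH4-p04 (g7)
SCOPE-beta2 v2 bd85a13a; data F0P3-p01 T2CELLS v1 ce7a73f9 (F2)–(F4), ALIGN-T2CELLS v1 5e64e5d6), as (β₂-S) «GENERIC cone cells are literal-independent» + (β₂-H) «literal-SPECIFIC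
cone cells are BALANCED: `N_f^{+}(j,b) = N_f^{−′}(j,b)`» (`SIG-beta2H.v1` 8901ac1d §1).  §2 of that SIG names the mechanism of (β₂-H): a label-reversing symmetry INSIDE the cell —
(H-a) on cells of tube level `b ≥ 1`, `z ↦ z·ε` on the glue fibre `Sol_{2b}(r_f)` with `ε` of norm one; (H-b) on the AXIS cells `b = 0`, `x₀ ↦ x₀·ε` on the order lattices
`Λ = x₀·𝒪_j` of `levelSet j 0` themselves.  THIS FILE is the datum-free ENGINE of both:
* §1 «HALF∕HALF FROM A LABEL-REVERSING SELF-EQUIVALENCE» — for a cell `S ⊆ X`, an equivalence `τ : X ≃ X` preserving `S`, and labels: (two labels) `P ↦ Q` along `τ` and `Q ↦ P`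
  along `τ⁻¹` on `S` ⇒ `#{x ∈ S ∣ P x} = #{x ∈ S ∣ Q x}` (`ncard_sep_eq_ncard_sep_of_equiv`); (one label) `P (τ x) ↔ ¬ P x` on `S` ⇒ `#{P} = #{¬P}` and, for finite `S`,
  `#S = 2·#{P}` (`ncard_sep_eq_ncard_sep_not_of_labelReversing`, `ncard_eq_two_mul_ncard_sep_of_labelReversing`; subtype form `natCard_subtype_eq_of_labelReversing`).
  NO finiteness is needed for the equality itself (`Set.ncard_congr`), so the consumer never has to prove the cell finite first.
* §2 «THE AXIS-CELL SYMMETRY» in the M-letters of ★ DEFS leaf `F0P3cDyRamToricCensusDefs` (`IsOrd`, `dualGen`, `levelSet ρ Θ α ϖE h j a`, `levelSetDep … μ`): for every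
  `ε` with `ε·Θε = 1` the pointwise action `Λ ↦ ε • Λ` on `AddSubgroup K` PRESERVES `levelSet … j a` (`smul_mem_levelSet_iff`: generator `x₀ ↦ ε·x₀`, dual generator
  `dualGen(ε·x₀) = (ε·Θε)·dualGen(x₀)` — `dualGen_mul_left`) AND `levelSetDep … j a μ` (`smul_mem_levelSetDep_iff`: the depth test vector `b` for `ε • Λ` is `Θε·b` for `Λ`, and
  `ε·μ·(Θε·b) = μ·b`), whence the per-cell balance for any label(s) exchanged by `ε •` (`ncard_levelSetDep_sep_eq_of_smul_exchange`, `ncard_levelSetDep_sep_eq_of_smul_labelReversing`,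
  and the `levelSet` twins; bridge `pointwise_smul_eq_map_mulLeft` to the `Λ.map (mulLeft z)` currency).  NEAREST PRIOR (cited, not restated): ★ `F0P3cDyRamConeWeightHalfSplit.
  cell_clauses_map_mulLeft` (LH4-p11 (g5), the (β) WEIGHT half-split of (ρ2b′-X)) moves PRESENTED cell clauses under `x₀ ↦ z·x₀` for a flip unit with `z·Θz = ξ′` ANY `ρ`-fixed
  unit (hence needs the order∕involution letters `hρρ hvρ hα hα1 hint hΘΘ hΘρ hvΘ hc …`); here `ξ′ = 1`, which needs NONE of them and is stated as an `iff` on the DEFS-leaf sets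
  themselves — the form the (β₂-H) balance consumes.  The EXISTENCE of the label-reversing `ε` (the non-square norm-one class at∕above the conductor — exactly the SPECIFIC rows) and the LABEL FACE
  (`lab (ε • Λ) ↔ ¬ lab Λ`, LH4-p13 (g8)) are the two remaining inputs of (β₂-H); the fibre twin (H-a) of §2 follows LH4-p04 (g7)'s (S-1) transport file.
HONEST LABEL.  Count-neutral set∕lattice algebra; nothing printed is asserted; no census law is stated; (β₂) stays a HYPOTHESIS; `HC_CM` is proved only modulo the 7 printed citations
(2 remaining named inputs: hLiu418 = `stmt-HodgeConjecture-24832`, h413 = `stmt-HodgeConjecture-24833`) until rung 0 closes.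
## References
* [Jacobowitz1962] R. Jacobowitz, *Hermitian forms over local fields*, Amer. J. Math. 84 (1962): §4 (dual lattices, modular components, norm-residue gluing).
* [Kottwitz1986BaseChangeUnits] R. E. Kottwitz, *Base change for unit elements of Hecke algebras*, Compositio Math. 60 (1986): §1 pp. 240–241 (orbital integrals of units as lattice counts).
* [Rogawski1990] J. D. Rogawski, *Automorphic Representations of Unitary Groups in Three Variables*, Ann. of Math. Stud. 123 (1990): §4.9 Prop. 4.9.1 (b) p. 55 (the labelled census of `f_{T₊}`).
-/

set_option autoImplicit false

namespace Summit.HodgeConjecture.HodgeConjecture.Cruxes.H413.F0P3cDyRamConeCellLabelBalance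

open scoped Pointwise WithZero
open Summit.HodgeConjecture.HodgeConjecture.Cruxes.H413.F0P3cDyRamToricCensusDefs

/-! ## §1 Half∕half from a label-reversing self-equivalence of a cell -/

section Abstract

variable {X : Type*}

/-- **TWO-LABEL TRANSPORT ALONG A CELL SYMMETRY.**  If `τ : X ≃ X` preserves the cell `S`, carries label `P` to label `Q` on `S`, and `τ⁻¹` carries `Q` back to `P` on `S`, then
`#{x ∈ S ∣ P x} = #{x ∈ S ∣ Q x}` (as `Set.ncard`; no finiteness needed). [cite: Kottwitz1986BaseChangeUnits, §1 pp. 240–241] -/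
theorem ncard_sep_eq_ncard_sep_of_equiv (S : Set X) (τ : X ≃ X) (hτ : ∀ x, τ x ∈ S ↔ x ∈ S) (P Q : X → Prop)
    (hPQ : ∀ x ∈ S, P x → Q (τ x)) (hQP : ∀ y ∈ S, Q y → P (τ.symm y)) :
    {x ∈ S | P x}.ncard = {x ∈ S | Q x}.ncard := by
  refine Set.ncard_congr (fun x _ => τ x) (fun x hx => ⟨(hτ x).2 hx.1, hPQ x hx.1 hx.2⟩)
    (fun a b _ _ h => τ.injective h) (fun y hy => ?_)
  have hyS : τ.symm y ∈ S := (hτ (τ.symm y)).1 (by rw [τ.apply_symm_apply]; exact hy.1)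
  exact ⟨τ.symm y, ⟨hyS, hQP y hy.1 hy.2⟩, τ.apply_symm_apply y⟩

/-- **HALF∕HALF FROM A LABEL-REVERSING SYMMETRY.**  If `τ : X ≃ X` preserves the cell `S` and REVERSES the label on it (`P (τ x) ↔ ¬ P x` for `x ∈ S`), then
`#{x ∈ S ∣ P x} = #{x ∈ S ∣ ¬ P x}` (no finiteness needed; a label-reversing `τ` is automatically fixed-point-free on `S`). [cite: Kottwitz1986BaseChangeUnits, §1 pp. 240–241] -/
theorem ncard_sep_eq_ncard_sep_not_of_labelReversing (S : Set X) (τ : X ≃ X) (hτ : ∀ x, τ x ∈ S ↔ x ∈ S) (P : X → Prop)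
    (hrev : ∀ x ∈ S, P (τ x) ↔ ¬ P x) :
    {x ∈ S | P x}.ncard = {x ∈ S | ¬ P x}.ncard := by
  refine ncard_sep_eq_ncard_sep_of_equiv S τ hτ P (fun x => ¬ P x) (fun x hx hP hτx => (hrev x hx).1 hτx hP) (fun y hy hQ => ?_)
  have hyS : τ.symm y ∈ S := (hτ (τ.symm y)).1 (by rw [τ.apply_symm_apply]; exact hy)
  have h := hrev (τ.symm y) hyS
  rw [τ.apply_symm_apply] at h
  by_contra hP
  exact hQ (h.2 hP)

/-- **A BALANCED FINITE CELL HAS EVEN SIZE `2·#{P}`.** [cite: Kottwitz1986BaseChangeUnits, §1 pp. 240–241] -/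
theorem ncard_eq_two_mul_ncard_sep_of_labelReversing (S : Set X) (hS : S.Finite) (τ : X ≃ X) (hτ : ∀ x, τ x ∈ S ↔ x ∈ S) (P : X → Prop)
    (hrev : ∀ x ∈ S, P (τ x) ↔ ¬ P x) :
    S.ncard = 2 * {x ∈ S | P x}.ncard := by
  have h := Set.ncard_inter_add_ncard_sdiff_eq_ncard S {x | P x} hS
  have h2 := ncard_sep_eq_ncard_sep_not_of_labelReversing S τ hτ P hrev
  change ({x ∈ S | P x}).ncard + ({x ∈ S | ¬ P x}).ncard = S.ncard at h
  omega

/-- **SUBTYPE FORM.**  A label-reversing self-equivalence of a type gives `Nat.card {x ∕∕ P x} = Nat.card {x ∕∕ ¬ P x}` (no finiteness needed).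
[cite: Kottwitz1986BaseChangeUnits, §1 pp. 240–241] -/
theorem natCard_subtype_eq_of_labelReversing (τ : X ≃ X) (P : X → Prop) (hrev : ∀ x, P (τ x) ↔ ¬ P x) :
    Nat.card {x // P x} = Nat.card {x // ¬ P x} := by
  refine Nat.card_congr (τ.subtypeEquiv fun x => ⟨fun hP hτx => (hrev x).1 hτx hP, fun h => ?_⟩)
  by_contra hP
  exact h ((hrev x).2 hP)

end Abstract

/-! ## §2 The axis-cell symmetry `Λ ↦ ε • Λ` (`ε·Θε = 1`) of `levelSet` ∕ `levelSetDep` -/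

section LevelSets

variable {K : Type*} [Field K] [Valued K ℤᵐ⁰] {ρ Θ : K →+* K} {α : K}

omit [Valued K ℤᵐ⁰] in
/-- The dual generator scales by the `Θ`-norm of the generator: `dualGen(ε·x₀) = (ε·Θε)·dualGen(x₀)`. [cite: Jacobowitz1962, §4] -/
theorem dualGen_mul_left (c h ε x₀ : K) : dualGen ρ Θ α c h (ε * x₀) = (ε * Θ ε) * dualGen ρ Θ α c h x₀ := by
  rw [dualGen_def, dualGen_def, map_mul]; ring

omit [Valued K ℤᵐ⁰] in
/-- A `Θ`-norm-one element is non-zero. [cite: Jacobowitz1962, §4] -/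
theorem ne_zero_of_mul_map_eq_one {ε : K} (hε : ε * Θ ε = 1) : ε ≠ 0 := fun h0 => by
  rw [h0, zero_mul] at hε; exact zero_ne_one hε

omit [Valued K ℤᵐ⁰] in
/-- The inverse of a `Θ`-norm-one element has `Θ`-norm one. [cite: Jacobowitz1962, §4] -/
theorem inv_mul_map_inv_eq_one {ε : K} (hε : ε * Θ ε = 1) : ε⁻¹ * Θ ε⁻¹ = 1 := by
  rw [map_inv₀, ← mul_inv, hε, inv_one]

omit [Valued K ℤᵐ⁰] in
/-- Bridge to the `map (mulLeft ·)` currency of ★ `F0P3cDyRamConeWeightHalfSplit.cell_clauses_map_mulLeft`: `ε • Λ = Λ.map (mulLeft ε)`. [cite: Jacobowitz1962, §4] -/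
theorem pointwise_smul_eq_map_mulLeft (ε : K) (Λ : AddSubgroup K) : ε • Λ = Λ.map (AddMonoidHom.mulLeft ε) := by
  ext x
  rw [AddSubgroup.mem_smul_pointwise_iff_exists, AddSubgroup.mem_map]
  constructor
  · rintro ⟨s, hs, rfl⟩
    exact ⟨s, hs, by rw [AddMonoidHom.coe_mulLeft, smul_eq_mul]⟩
  · rintro ⟨s, hs, rfl⟩
    exact ⟨s, hs, by rw [AddMonoidHom.coe_mulLeft, smul_eq_mul]⟩

/-- **`ε • levelSet = levelSet` (one direction).**  For `ε·Θε = 1`: if `Λ = x₀·𝒪_j ∈ levelSet ρ Θ α ϖE h j a` then `ε • Λ = (ε·x₀)·𝒪_j ∈ levelSet ρ Θ α ϖE h j a` — same order,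
same dual generator (`dualGen(ε·x₀) = dualGen(x₀)`), hence the same integrality ∕ primitivity ∕ level clauses. [cite: Jacobowitz1962, §4] -/
theorem smul_mem_levelSet_of_mem {ε : K} (hε : ε * Θ ε = 1) (ϖE h : K) (j a : ℕ) {Λ : AddSubgroup K}
    (hΛ : Λ ∈ levelSet ρ Θ α ϖE h j a) : ε • Λ ∈ levelSet ρ Θ α ϖE h j a := by
  have hε0 : ε ≠ 0 := ne_zero_of_mul_map_eq_one hε
  obtain ⟨x₀, hx₀, hmem, hyO, hyprim, hylev⟩ := hΛ
  refine ⟨ε * x₀, mul_ne_zero hε0 hx₀, fun x => ?_, ?_, ?_, ?_⟩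
  · rw [AddSubgroup.mem_smul_pointwise_iff_exists]
    constructor
    · rintro ⟨s, hs, rfl⟩
      obtain ⟨z, hz, rfl⟩ := (hmem s).1 hs
      exact ⟨z, hz, by rw [smul_eq_mul, mul_assoc]⟩
    · rintro ⟨z, hz, rfl⟩
      exact ⟨x₀ * z, (hmem _).2 ⟨z, hz, rfl⟩, by rw [smul_eq_mul, mul_assoc]⟩
  · rwa [dualGen_mul_left, hε, one_mul]
  · rwa [dualGen_mul_left, hε, one_mul]
  · rwa [dualGen_mul_left, hε, one_mul]

/-- **`Λ ↦ ε • Λ` PRESERVES `levelSet ρ Θ α ϖE h j a`** (`ε·Θε = 1`; iff, by the same statement for `ε⁻¹`). [cite: Jacobowitz1962, §4] -/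
theorem smul_mem_levelSet_iff {ε : K} (hε : ε * Θ ε = 1) (ϖE h : K) (j a : ℕ) (Λ : AddSubgroup K) :
    ε • Λ ∈ levelSet ρ Θ α ϖE h j a ↔ Λ ∈ levelSet ρ Θ α ϖE h j a := by
  refine ⟨fun hΛ => ?_, smul_mem_levelSet_of_mem hε ϖE h j a⟩
  have h' := smul_mem_levelSet_of_mem (ρ := ρ) (α := α) (inv_mul_map_inv_eq_one hε) ϖE h j a hΛ
  rwa [smul_smul, inv_mul_cancel₀ (ne_zero_of_mul_map_eq_one hε), one_smul] at h'

/-- **`ε • levelSetDep = levelSetDep` (one direction).**  For `ε·Θε = 1`: the depth clause `μ·(ε • Λ)^♯ ⊆ ε • Λ` follows from `μ·Λ^♯ ⊆ Λ`, because a test vector `b` pairs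
integrally with `ε • Λ` under `Tr(h·Θ(·)·b)` iff `Θε·b` pairs integrally with `Λ`, and `ε·(μ·(Θε·b)) = μ·b`. [cite: Jacobowitz1962, §4] [cite: Kottwitz1986BaseChangeUnits, §1 pp. 240–241] -/
theorem smul_mem_levelSetDep_of_mem {ε : K} (hε : ε * Θ ε = 1) (ϖE h : K) (j a : ℕ) (μ : K) {Λ : AddSubgroup K}
    (hΛ : Λ ∈ levelSetDep ρ Θ α ϖE h j a μ) : ε • Λ ∈ levelSetDep ρ Θ α ϖE h j a μ := by
  refine ⟨smul_mem_levelSet_of_mem hε ϖE h j a hΛ.1, fun b hb => ?_⟩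
  have hb' : ∀ x ∈ Λ, Valued.v (h * Θ x * (Θ ε * b) + ρ (h * Θ x * (Θ ε * b))) ≤ 1 := fun x hx => by
    have hx' := hb (ε • x) (AddSubgroup.smul_mem_pointwise_smul x ε Λ hx)
    rwa [smul_eq_mul, map_mul, show h * (Θ ε * Θ x) * b = h * Θ x * (Θ ε * b) by ring] at hx'
  have hμ : μ * (Θ ε * b) ∈ Λ := hΛ.2 (Θ ε * b) hb'
  have hεμ : ε • (μ * (Θ ε * b)) = μ * b := by
    rw [smul_eq_mul, show ε * (μ * (Θ ε * b)) = (ε * Θ ε) * (μ * b) by ring, hε, one_mul]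
  rw [← hεμ]
  exact AddSubgroup.smul_mem_pointwise_smul _ ε Λ hμ

/-- **`Λ ↦ ε • Λ` PRESERVES `levelSetDep ρ Θ α ϖE h j a μ`** (`ε·Θε = 1`; iff).  This is the (H-b) symmetry of the AXIS cells `b = 0` of `SIG-beta2H.v1` §2, and equally of every
depth-refined cell. [cite: Jacobowitz1962, §4] [cite: Kottwitz1986BaseChangeUnits, §1 pp. 240–241] -/
theorem smul_mem_levelSetDep_iff {ε : K} (hε : ε * Θ ε = 1) (ϖE h : K) (j a : ℕ) (μ : K) (Λ : AddSubgroup K) :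
    ε • Λ ∈ levelSetDep ρ Θ α ϖE h j a μ ↔ Λ ∈ levelSetDep ρ Θ α ϖE h j a μ := by
  refine ⟨fun hΛ => ?_, smul_mem_levelSetDep_of_mem hε ϖE h j a μ⟩
  have h' := smul_mem_levelSetDep_of_mem (ρ := ρ) (α := α) (inv_mul_map_inv_eq_one hε) ϖE h j a μ hΛ
  rwa [smul_smul, inv_mul_cancel₀ (ne_zero_of_mul_map_eq_one hε), one_smul] at h'

/-- **TWO-LABEL BALANCE OF A DEPTH CELL UNDER `ε •`.**  For `ε·Θε = 1` and two labels `P`, `Q` on lattices with `P Λ → Q (ε • Λ)` and `Q Λ → P (ε⁻¹ • Λ)` on the cell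
`levelSetDep ρ Θ α ϖE h j a μ`: `#{Λ ∈ cell ∣ P Λ} = #{Λ ∈ cell ∣ Q Λ}`. (For (β₂-H): `P = label +`, `Q = label −′`.) [cite: Rogawski1990, §4.9 Prop. 4.9.1 (b) p. 55]
[cite: Kottwitz1986BaseChangeUnits, §1 pp. 240–241] -/
theorem ncard_levelSetDep_sep_eq_of_smul_exchange {ε : K} (hε : ε * Θ ε = 1) (ϖE h : K) (j a : ℕ) (μ : K) (P Q : AddSubgroup K → Prop)
    (hPQ : ∀ Λ ∈ levelSetDep ρ Θ α ϖE h j a μ, P Λ → Q (ε • Λ)) (hQP : ∀ Λ ∈ levelSetDep ρ Θ α ϖE h j a μ, Q Λ → P (ε⁻¹ • Λ)) :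
    {Λ ∈ levelSetDep ρ Θ α ϖE h j a μ | P Λ}.ncard = {Λ ∈ levelSetDep ρ Θ α ϖE h j a μ | Q Λ}.ncard := by
  have hε0 : ε ≠ 0 := ne_zero_of_mul_map_eq_one hε
  let τ : AddSubgroup K ≃ AddSubgroup K :=
    ⟨fun Λ => ε • Λ, fun Λ => ε⁻¹ • Λ, fun Λ => by simp only [smul_smul, inv_mul_cancel₀ hε0, one_smul],
      fun Λ => by simp only [smul_smul, mul_inv_cancel₀ hε0, one_smul]⟩
  exact ncard_sep_eq_ncard_sep_of_equiv _ τ (fun Λ => smul_mem_levelSetDep_iff hε ϖE h j a μ Λ) P Q hPQ hQP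

/-- **(H-b) BALANCE OF A DEPTH CELL FROM A LABEL-REVERSING `ε •`.**  For `ε·Θε = 1` and a label with `lab (ε • Λ) ↔ ¬ lab Λ` on the cell `levelSetDep ρ Θ α ϖE h j a μ`:
`#{Λ ∈ cell ∣ lab Λ} = #{Λ ∈ cell ∣ ¬ lab Λ}` — the cell is balanced half∕half. [cite: Rogawski1990, §4.9 Prop. 4.9.1 (b) p. 55] [cite: Kottwitz1986BaseChangeUnits, §1 pp. 240–241] -/
theorem ncard_levelSetDep_sep_eq_of_smul_labelReversing {ε : K} (hε : ε * Θ ε = 1) (ϖE h : K) (j a : ℕ) (μ : K) (lab : AddSubgroup K → Prop)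
    (hrev : ∀ Λ ∈ levelSetDep ρ Θ α ϖE h j a μ, lab (ε • Λ) ↔ ¬ lab Λ) :
    {Λ ∈ levelSetDep ρ Θ α ϖE h j a μ | lab Λ}.ncard = {Λ ∈ levelSetDep ρ Θ α ϖE h j a μ | ¬ lab Λ}.ncard := by
  have hε0 : ε ≠ 0 := ne_zero_of_mul_map_eq_one hε
  let τ : AddSubgroup K ≃ AddSubgroup K :=
    ⟨fun Λ => ε • Λ, fun Λ => ε⁻¹ • Λ, fun Λ => by simp only [smul_smul, inv_mul_cancel₀ hε0, one_smul],
      fun Λ => by simp only [smul_smul, mul_inv_cancel₀ hε0, one_smul]⟩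
  exact ncard_sep_eq_ncard_sep_not_of_labelReversing _ τ (fun Λ => smul_mem_levelSetDep_iff hε ϖE h j a μ Λ) lab hrev

/-- **(H-b) BALANCE OF A `levelSet` CELL FROM A LABEL-REVERSING `ε •`** (the u-free cell; same proof). [cite: Rogawski1990, §4.9 Prop. 4.9.1 (b) p. 55]
[cite: Kottwitz1986BaseChangeUnits, §1 pp. 240–241] -/
theorem ncard_levelSet_sep_eq_of_smul_labelReversing {ε : K} (hε : ε * Θ ε = 1) (ϖE h : K) (j a : ℕ) (lab : AddSubgroup K → Prop)
    (hrev : ∀ Λ ∈ levelSet ρ Θ α ϖE h j a, lab (ε • Λ) ↔ ¬ lab Λ) :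
    {Λ ∈ levelSet ρ Θ α ϖE h j a | lab Λ}.ncard = {Λ ∈ levelSet ρ Θ α ϖE h j a | ¬ lab Λ}.ncard := by
  have hε0 : ε ≠ 0 := ne_zero_of_mul_map_eq_one hε
  let τ : AddSubgroup K ≃ AddSubgroup K :=
    ⟨fun Λ => ε • Λ, fun Λ => ε⁻¹ • Λ, fun Λ => by simp only [smul_smul, inv_mul_cancel₀ hε0, one_smul],
      fun Λ => by simp only [smul_smul, mul_inv_cancel₀ hε0, one_smul]⟩
  exact ncard_sep_eq_ncard_sep_not_of_labelReversing _ τ (fun Λ => smul_mem_levelSet_iff hε ϖE h j a Λ) lab hrev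

/-- **A FINITE BALANCED DEPTH CELL HAS EVEN SIZE**: under a label-reversing `ε •`, `#cell = 2·#{Λ ∈ cell ∣ lab Λ}`. [cite: Kottwitz1986BaseChangeUnits, §1 pp. 240–241] -/
theorem ncard_levelSetDep_eq_two_mul_of_smul_labelReversing {ε : K} (hε : ε * Θ ε = 1) (ϖE h : K) (j a : ℕ) (μ : K)
    (hfin : (levelSetDep ρ Θ α ϖE h j a μ).Finite) (lab : AddSubgroup K → Prop)
    (hrev : ∀ Λ ∈ levelSetDep ρ Θ α ϖE h j a μ, lab (ε • Λ) ↔ ¬ lab Λ) :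
    (levelSetDep ρ Θ α ϖE h j a μ).ncard = 2 * {Λ ∈ levelSetDep ρ Θ α ϖE h j a μ | lab Λ}.ncard := by
  have hε0 : ε ≠ 0 := ne_zero_of_mul_map_eq_one hε
  let τ : AddSubgroup K ≃ AddSubgroup K :=
    ⟨fun Λ => ε • Λ, fun Λ => ε⁻¹ • Λ, fun Λ => by simp only [smul_smul, inv_mul_cancel₀ hε0, one_smul],
      fun Λ => by simp only [smul_smul, mul_inv_cancel₀ hε0, one_smul]⟩
  exact ncard_eq_two_mul_ncard_sep_of_labelReversing _ hfin τ (fun Λ => smul_mem_levelSetDep_iff hε ϖE h j a μ Λ) lab hrev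

end LevelSets

end Summit.HodgeConjecture.HodgeConjecture.Cruxes.H413.F0P3cDyRamConeCellLabelBalance
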